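import Summits.HodgeConjecture.CorCM.Census.TwistScrewUp

/-!
# Uniform twist generation, XII: THE COVERING FAMILY WITH A PRESCRIBED FACE — descent, star reduction on the UPPER classes, and the
# screw face inside the count

COR-CM (cell `pub-hodgecm2`), count-neutral kernel combinatorics by the binder seat b09 (gen 37; lane UNIFORM TWIST GENERATION, part XII), on
parts I (`descent`, `single_sub_thetaG_mem_of`), II, IV (`exists_cover`, the pattern), X–XI (`upCl`, its calculus, `exists_choice_up`) used BY
NAME.  Theorems only: no definition, no `decide`, no certificate, no named fact, no `sorry`.
HONEST FRAMING: `HC_CM` is NOT proved, here or anywhere in the tree; nothing here is a period or a headline.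

**THE COVERING FAMILY WITH A PRESCRIBED FACE** (`exists_cover_prescribed`, along a datum `θ : G ≃ ℤ/2n × B`).  Given a TIED type `ψ` (every
centre realises its potential — part XIV: the screw type) and two distinct deviation places `p ≠ q` of `cst x ∖ ψ`, there is a finite
`S ⊆ gfaceSet` with at most one member per block of potential `≥ 2` — at the block representative: toward the UPPER centre whenever the
representative lies in an upper class (part XI `exists_choice_up`), and at the block of `ψ` THE TRANSLATE OF THE PRESCRIBED FACE `gface ψ p q`
(legitimate: `x` realises the potential of `ψ`, and a tied representative lies in no upper class) — such that for every submodule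
`L ⊇ ℤ⟨base changes of S⟩`:
* (a) every vector is congruent modulo `L` to one supported on the residual types (potential `≤ 1`) — part I `descent`;
* (b) `[Φ] − θ_{cst a}(typeSum [Φ]) ∈ L` for every centre `a` and every `Φ` in the UPPER class `upCl a` (hence on the near class, part XI
  `near_subset_up`) — part I `single_sub_thetaG_mem_of` on `upCl a`, base-change stable, uniquely indexed and flip-closed (part XI);
* (c) `gface ψ p q ∈ L` — the prescribed face is paid for by the count.
§1 also records the face decomposition `single_sub_thetaG_mem_of_gface` (one step of the Prior induction) used at `ψ` itself in part XV.

## References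
* [Pohlmann1968] H. Pohlmann, Algebraic cycles on abelian varieties of complex multiplication type, Ann. of Math. 88 (1968), Thm 1.
* [Milne1999] J. S. Milne, Lefschetz motives and the Tate conjecture, Compositio Math. 117 (1999), Prop. 2.1, p. 54.
-/

namespace Summit.HodgeConjecture.CorCM.Census.TwistGeneration

open Finset
open Summit.HodgeConjecture.CorCM.Prior.AllgGroup.RfwfAllgGroup
open Summit.HodgeConjecture.CorCM.Census.BlockParity
open Summit.HodgeConjecture.CorCM.Census.Coinvariant

noncomputable section

variable {G : Type*} [Group G] [Fintype G] [DecidableEq G] {c : G}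

/-! ## §1 One step of the star induction -/

/-- **Face decomposition**: if `L` holds the face `gface Φ s s'` (distinct places) and the star defects `[·] − θ_{T₀}(typeSum [·])` of its three other
corners, it holds the star defect of `Φ`. [folklore] -/
theorem single_sub_thetaG_mem_of_gface (hc2 : c * c = 1) (T₀ Φ : CMF G c) {s s' : G} (hs' : s' ∉ orb c s)
    (L : Submodule ℤ (CMF G c →₀ ℤ)) (hface : gface c hc2 Φ s s' ∈ L)
    (h1 : Finsupp.single (oflipCM c hc2 s Φ) 1 - thetaG c hc2 T₀ (typeSum G c (Finsupp.single (oflipCM c hc2 s Φ) 1)) ∈ L)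
    (h2 : Finsupp.single (oflipCM c hc2 s' Φ) 1 - thetaG c hc2 T₀ (typeSum G c (Finsupp.single (oflipCM c hc2 s' Φ) 1)) ∈ L)
    (h3 : Finsupp.single (oflipCM c hc2 s (oflipCM c hc2 s' Φ)) 1
      - thetaG c hc2 T₀ (typeSum G c (Finsupp.single (oflipCM c hc2 s (oflipCM c hc2 s' Φ)) 1)) ∈ L) :
    Finsupp.single Φ 1 - thetaG c hc2 T₀ (typeSum G c (Finsupp.single Φ 1)) ∈ L := by
  have key : Finsupp.single Φ 1 - thetaG c hc2 T₀ (typeSum G c (Finsupp.single Φ 1))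
      = (gface c hc2 Φ s s' - thetaG c hc2 T₀ (typeSum G c (gface c hc2 Φ s s')))
        + (Finsupp.single (oflipCM c hc2 s Φ) 1 - thetaG c hc2 T₀ (typeSum G c (Finsupp.single (oflipCM c hc2 s Φ) 1)))
        + (Finsupp.single (oflipCM c hc2 s' Φ) 1 - thetaG c hc2 T₀ (typeSum G c (Finsupp.single (oflipCM c hc2 s' Φ) 1)))
        - (Finsupp.single (oflipCM c hc2 s (oflipCM c hc2 s' Φ)) 1
            - thetaG c hc2 T₀ (typeSum G c (Finsupp.single (oflipCM c hc2 s (oflipCM c hc2 s' Φ)) 1))) := by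
    simp only [gface, map_add, map_sub]
    abel
  rw [key, typeSum_gface c hc2 Φ hs', map_zero, sub_zero]
  exact Submodule.sub_mem _ (Submodule.add_mem _ (Submodule.add_mem _ hface h1) h2) h3

/-! ## §2 The covering family with a prescribed face -/

variable {B : Type} [AddGroup B]
variable {n : ℕ} [NeZero n] (θ : G ≃ ZMod (2 * n) × B)
variable (hθ : ∀ P Q : G, θ (P * Q) = θ P + θ Q) (hθc : θ c = (((n : ℕ) : ZMod (2 * n)), 0))

/-- **THE COVERING FAMILY WITH A PRESCRIBED FACE.**  Along a datum: for a tied type `ψ` and distinct deviation places `p ≠ q` of `cst x ∖ ψ` there is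
a finite `S ⊆ gfaceSet` with at most one member per block of potential `≥ 2` such that, for every submodule `L ⊇ ℤ⟨base changes of S⟩`, (a) every
vector is congruent modulo `L` to one supported on types of potential `≤ 1`, (b) `[Φ] − θ_{cst a}(typeSum [Φ]) ∈ L` for every centre `a` and every
`Φ ∈ upCl a`, and (c) `gface ψ p q ∈ L`. [folklore] -/
theorem exists_cover_prescribed (hc2 : c * c = 1) {ψ : CMF G c} (hψ : ∀ a' : ZMod (2 * n), ddist (cst θ hθ hθc a') ψ = pot θ hθ hθc ψ)
    {x : ZMod (2 * n)} {p q : G} (hp : p ∈ (cst θ hθ hθc x).1 \ ψ.1) (hq : q ∈ (cst θ hθ hθc x).1 \ ψ.1) (hpq : p ≠ q) :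
    ∃ S : Finset (CMF G c →₀ ℤ), (↑S ⊆ gfaceSet G c hc2) ∧
      S.card ≤ (univ.filter fun Bk : Block c => 2 ≤ pot θ hθ hθc Bk.out).card ∧
      ∀ L : Submodule ℤ (CMF G c →₀ ℤ), Submodule.span ℤ (translates c S) ≤ L →
        (∀ y : CMF G c →₀ ℤ, ∃ y' : CMF G c →₀ ℤ, y - y' ∈ L ∧ ∀ Ψ ∈ y'.support, pot θ hθ hθc Ψ ≤ 1) ∧
        (∀ (a : ZMod (2 * n)) (Φ : CMF G c), Φ ∈ upCl θ hθ hθc a →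
          Finsupp.single Φ 1 - thetaG c hc2 (cst θ hθ hθc a) (typeSum G c (Finsupp.single Φ 1)) ∈ L) ∧
        gface c hc2 ψ p q ∈ L := by
  classical
  -- the choice at every block representative of potential `≥ 2`; at the block of `ψ`, the transported prescribed face
  have hch : ∀ Bk : Block c, ∃ τ : ZMod (2 * n) × G × G, (2 ≤ pot θ hθ hθc Bk.out →
      pot θ hθ hθc Bk.out = ddist (cst θ hθ hθc τ.1) Bk.out ∧ (∀ a'' : ZMod (2 * n), Bk.out ∈ upCl θ hθ hθc a'' → τ.1 = a'') ∧
        τ.2.1 ∈ (cst θ hθ hθc τ.1).1 \ Bk.out.1 ∧ τ.2.2 ∈ (cst θ hθ hθc τ.1).1 \ Bk.out.1 ∧ τ.2.1 ≠ τ.2.2) ∧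
      (Bk = blk c ψ → ∃ R : G, rt c R Bk.out = ψ ∧ τ.2.1 * R⁻¹ = p ∧ τ.2.2 * R⁻¹ = q) := by
    intro Bk
    by_cases hBψ : Bk = blk c ψ
    · subst hBψ
      obtain ⟨R, hR⟩ := exists_rt_eq_of_blk_eq c (Quotient.out_eq (blk c ψ) : blk c (blk c ψ).out = blk c ψ)
      have hcst : rt c R (cst θ hθ hθc (x + (θ R).1)) = cst θ hθ hθc x := by rw [rt_cst, add_sub_cancel_right]
      refine ⟨(x + (θ R).1, p * R, q * R), fun _ => ⟨?_, ?_, ?_, ?_, fun h => hpq (mul_right_cancel h)⟩,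
        fun _ => ⟨R, hR, by rw [mul_inv_cancel_right], by rw [mul_inv_cancel_right]⟩⟩
      · show pot θ hθ hθc (blk c ψ).out = ddist (cst θ hθ hθc (x + (θ R).1)) (blk c ψ).out
        rw [← ddist_rt R (cst θ hθ hθc (x + (θ R).1)) (blk c ψ).out, hcst, hR, hψ x]
        have h := pot_rt θ hθ hθc R (blk c ψ).out
        rw [hR] at h
        exact h.symm
      · intro a'' ha''
        have h := up_rt θ hθ hθc ha'' R
        rw [hR] at h
        exact absurd h (not_up_of_tied θ hθ hθc hψ _)
      · show p * R ∈ (cst θ hθ hθc (x + (θ R).1)).1 \ (blk c ψ).out.1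
        exact (mem_sdiff_rt_iff R _ _ p).mp (by rw [hcst, hR]; exact hp)
      · show q * R ∈ (cst θ hθ hθc (x + (θ R).1)).1 \ (blk c ψ).out.1
        exact (mem_sdiff_rt_iff R _ _ q).mp (by rw [hcst, hR]; exact hq)
    · by_cases h : 2 ≤ pot θ hθ hθc Bk.out
      · obtain ⟨a, t, t', h1, h2, h3, h4, h5⟩ := exists_choice_up θ hθ hθc Bk.out h
        exact ⟨(a, t, t'), fun _ => ⟨h1, h2, h3, h4, h5⟩, fun h' => absurd h' hBψ⟩
      · exact ⟨(0, 1, 1), fun h' => absurd h' h, fun h' => absurd h' hBψ⟩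
  choose τ hτ using hch
  set NI : Finset (Block c) := univ.filter fun Bk : Block c => 2 ≤ pot θ hθ hθc Bk.out with hNI
  set S : Finset (CMF G c →₀ ℤ) := NI.image fun Bk => gface c hc2 Bk.out (τ Bk).2.1 (τ Bk).2.2 with hS
  have hSsub : (↑S : Set (CMF G c →₀ ℤ)) ⊆ gfaceSet G c hc2 := by
    intro y hy
    obtain ⟨Bk, hBk, rfl⟩ := mem_image.mp (mem_coe.mp hy)
    obtain ⟨-, -, h3, h4, h5⟩ := (hτ Bk).1 (mem_filter.mp hBk).2
    exact ⟨Bk.out, _, _, not_mem_orb_of_mem (mem_sdiff.mp h3).1 (mem_sdiff.mp h4).1 h5, rfl⟩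
  refine ⟨S, hSsub, card_image_le, fun L hL => ?_⟩
  -- potentials are block invariants
  have hpot_out : ∀ Ψ : CMF G c, pot θ hθ hθc (blk c Ψ).out = pot θ hθ hθc Ψ := by
    intro Ψ
    obtain ⟨Q, hQ⟩ := exists_rt_eq_of_blk_eq c (Quotient.out_eq (blk c Ψ) : blk c (blk c Ψ).out = blk c Ψ)
    rw [← pot_rt θ hθ hθc Q, hQ]
  -- the translated block face through an arbitrary type of potential `≥ 2`
  have hface : ∀ Ψ : CMF G c, 2 ≤ pot θ hθ hθc Ψ → ∃ Q : G, rt c Q (blk c Ψ).out = Ψ ∧ (blk c Ψ) ∈ NI ∧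
      gface c hc2 Ψ ((τ (blk c Ψ)).2.1 * Q⁻¹) ((τ (blk c Ψ)).2.2 * Q⁻¹) ∈ L := by
    intro Ψ hΨ
    obtain ⟨Q, hQ⟩ := exists_rt_eq_of_blk_eq c (Quotient.out_eq (blk c Ψ) : blk c (blk c Ψ).out = blk c Ψ)
    have hBNI : blk c Ψ ∈ NI := mem_filter.mpr ⟨mem_univ _, by rw [hpot_out]; exact hΨ⟩
    refine ⟨Q, hQ, hBNI, ?_⟩
    have e : gface c hc2 Ψ ((τ (blk c Ψ)).2.1 * Q⁻¹) ((τ (blk c Ψ)).2.2 * Q⁻¹) =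
        Finsupp.mapDomain (rt c Q) (gface c hc2 (blk c Ψ).out (τ (blk c Ψ)).2.1 (τ (blk c Ψ)).2.2) := by
      rw [mapDomain_rt_gface, hQ]
    rw [e]
    exact hL (Submodule.subset_span ⟨Q, _, mem_image_of_mem _ hBNI, rfl⟩)
  refine ⟨fun y => ?_, fun a => ?_, ?_⟩
  · -- (a) descent on the potential
    refine descent c (pot θ hθ hθc) (fun Ψ => pot θ hθ hθc Ψ ≤ 1) hc2 L (fun Ψ hΨ => ?_) y
    have hΨ2 : 2 ≤ pot θ hθ hθc Ψ := by omega
    obtain ⟨Q, hQ, hBNI, hmem⟩ := hface Ψ hΨ2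
    obtain ⟨h1, -, h3, h4, h5⟩ := (hτ (blk c Ψ)).1 (mem_filter.mp hBNI).2
    set a := (τ (blk c Ψ)).1
    set t := (τ (blk c Ψ)).2.1
    set t' := (τ (blk c Ψ)).2.2
    have hpotΨ : pot θ hθ hθc Ψ = ddist (cst θ hθ hθc (a - (θ Q).1)) Ψ := by
      rw [← hQ, pot_rt, ← rt_cst θ hθ hθc, ddist_rt]; exact h1
    have hs : t * Q⁻¹ ∈ (cst θ hθ hθc (a - (θ Q).1)).1 \ Ψ.1 := by
      rw [← rt_cst θ hθ hθc, ← hQ, mem_sdiff_rt_iff, inv_mul_cancel_right]; exact h3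
    have hs' : t' * Q⁻¹ ∈ (cst θ hθ hθc (a - (θ Q).1)).1 \ Ψ.1 := by
      rw [← rt_cst θ hθ hθc, ← hQ, mem_sdiff_rt_iff, inv_mul_cancel_right]; exact h4
    have hss' : t * Q⁻¹ ≠ t' * Q⁻¹ := fun h => h5 (mul_right_cancel h)
    have hs'' : t * Q⁻¹ ∈ (cst θ hθ hθc (a - (θ Q).1)).1 \ (oflipCM c hc2 (t' * Q⁻¹) Ψ).1 := by
      rw [dev_oflip c hc2 (mem_sdiff.mp hs').1 (mem_sdiff.mp hs').2]; exact mem_erase.mpr ⟨hss', hs⟩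
    have d1 := ddist_oflipCM_of_mem_sdiff hc2 hs
    have d2 := ddist_oflipCM_of_mem_sdiff hc2 hs'
    have d3 := ddist_oflipCM_of_mem_sdiff hc2 hs''
    refine ⟨t * Q⁻¹, t' * Q⁻¹, hmem, ?_, ?_, ?_⟩
    · have := pot_le θ hθ hθc (oflipCM c hc2 (t * Q⁻¹) Ψ) (a - (θ Q).1); omega
    · have := pot_le θ hθ hθc (oflipCM c hc2 (t' * Q⁻¹) Ψ) (a - (θ Q).1); omega
    · have := pot_le θ hθ hθc (oflipCM c hc2 (t * Q⁻¹) (oflipCM c hc2 (t' * Q⁻¹) Ψ)) (a - (θ Q).1); omega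
  · -- (b) star reduction on the upper class of `a`
    refine single_sub_thetaG_mem_of c (cst θ hθ hθc a) (fun Φ => Φ ∈ upCl θ hθ hθc a) hc2 L (fun Φ hΦ hdev => ?_)
    have hΦ2 : 2 ≤ pot θ hθ hθc Φ := by rw [pot_eq_of_up θ hθ hθc hΦ, ddist]; exact hdev
    obtain ⟨Q, hQ, hBNI, hmem⟩ := hface Φ hΦ2
    obtain ⟨-, h2, h3, h4, h5⟩ := (hτ (blk c Φ)).1 (mem_filter.mp hBNI).2
    -- the representative lies in the upper class of `a − (θQ⁻¹).1`, so the choice was made toward it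
    have hout : (blk c Φ).out ∈ upCl θ hθ hθc (a - (θ Q⁻¹).1) := by
      rw [← rt_inv_rt c Q (blk c Φ).out, hQ]; exact up_rt θ hθ hθc hΦ Q⁻¹
    have ha : (τ (blk c Φ)).1 = a - (θ Q⁻¹).1 := h2 _ hout
    have hcst : rt c Q (cst θ hθ hθc (τ (blk c Φ)).1) = cst θ hθ hθc a := by
      rw [rt_cst, ha, map_inv_eq θ hθ, Prod.fst_neg]; ring_nf
    set t := (τ (blk c Φ)).2.1
    set t' := (τ (blk c Φ)).2.2
    have hs : t * Q⁻¹ ∈ (cst θ hθ hθc a).1 \ Φ.1 := by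
      have h := (mem_sdiff_rt_iff Q (cst θ hθ hθc (τ (blk c Φ)).1) (blk c Φ).out (t * Q⁻¹)).mpr
        (by rw [inv_mul_cancel_right]; exact h3)
      rwa [hcst, hQ] at h
    have hs' : t' * Q⁻¹ ∈ (cst θ hθ hθc a).1 \ Φ.1 := by
      have h := (mem_sdiff_rt_iff Q (cst θ hθ hθc (τ (blk c Φ)).1) (blk c Φ).out (t' * Q⁻¹)).mpr
        (by rw [inv_mul_cancel_right]; exact h4)
      rwa [hcst, hQ] at h
    have hss' : t * Q⁻¹ ≠ t' * Q⁻¹ := fun h => h5 (mul_right_cancel h)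
    exact ⟨t * Q⁻¹, t' * Q⁻¹, hs, hs', hss', hmem, up_oflipCM θ hθ hθc hc2 hΦ hs, up_oflipCM θ hθ hθc hc2 hΦ hs',
      up_oflipCM_oflipCM θ hθ hθc hc2 hΦ hs hs' hss'⟩
  · -- (c) the prescribed face
    have hψ2 : 2 ≤ pot θ hθ hθc ψ := by
      rw [← hψ x, ddist]
      exact Finset.one_lt_card.mpr ⟨p, hp, q, hq, hpq⟩
    have hBNI : blk c ψ ∈ NI := mem_filter.mpr ⟨mem_univ _, by rw [hpot_out]; exact hψ2⟩
    obtain ⟨R, hR, hpR, hqR⟩ := (hτ (blk c ψ)).2 rfl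
    have e : gface c hc2 ψ p q = Finsupp.mapDomain (rt c R) (gface c hc2 (blk c ψ).out (τ (blk c ψ)).2.1 (τ (blk c ψ)).2.2) := by
      rw [mapDomain_rt_gface, hR, hpR, hqR]
    rw [e]
    exact hL (Submodule.subset_span ⟨R, _, mem_image_of_mem _ hBNI, rfl⟩)

end

end Summit.HodgeConjecture.CorCM.Census.TwistGeneration
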